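import Literature.AlgebraicGeometry.Motives.GeneratingSectionsClosedImmersionBaseChange
import Literature.AlgebraicGeometry.Motives.GeneratingSectionsFrameChange
import Literature.AlgebraicGeometry.Morphisms.AffineFpqcDescent
import Literature.AlgebraicGeometry.Morphisms.SectionsBaseChangeSpan
import Literature.AlgebraicGeometry.Morphisms.SectionsLiftOfFibreVanishing
import Literature.AlgebraicGeometry.Modules.ModuleSectionsFlatBaseChange
import Literature.AlgebraicGeometry.Morphisms.FormalFunctionsModuleComplete
import Literature.Algebra.Homology.HomologyAddEquivTransfer
import HarnessLib

/-!
# Embedding families of sections DOWN and UP a field extension (and across an isomorphism)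

Topic `Literature/AlgebraicGeometry/Motives`; namespace `Literature.AlgebraicGeometry.Motives[.GeneratingSections]`; THEOREMS ONLY
(no definition, no named fact, no instance, no notation, no `sorry`).  Cell hodgecm-mathlib, F-6 functor side, the generic half
of LEFSCHETZ (B4) (B-plan1 (g16) 07:58:04Z; consumers `AbelianVarieties/LefschetzThreeThetaVeryAmple`, (FS-a′)).  Currency: an
`𝒪_Y`-module `E` with a rank-one frame system `F` and a family `t : ι → Γ(Y, E)`; its coefficient datum
`CocycleSections.ofFrameSystem F h1 t` (★ `Motives/GeneratingSectionsOfLineBundle`), the generating-sections datum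
`GeneratingSections.ofCocycleSections` and its morphism `toProj f : Y → ℙ_k` (★ `Motives/MorphismsToProjectiveSpace`, Hartshorne
II Thm. 7.1); «`t` embeds» = that morphism is a closed immersion.  HC_CM is proved only modulo the 7 printed citations until rung
0 closes; nothing here is about HC.

* §0 `exists_fin_span_secMod_eq_top` — a coherent module on a proper `k`-scheme has a FINITE family spanning `Γ` over `k`
  (★ `moduleFinite_msections_of_coh`, Görtz–Wedhorn II Thm. 23.17).
* §1 **DOWN** `GeneratingSections.isClosedImmersion_toProj_of_fieldExtension` — `Y′ = Y ×_K Spec L`, `t` spanning `Γ(Y, E)` over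
  `K`; if some family of sections of `h^*E` (in the pulled-back frames) generates and embeds `Y′`, then `t` generates `E` and embeds
  `Y` (flat base change of `H⁰` ★ `span_unitSectionLE_top_eq_top_of_flat`, the span form of the fibre step ★
  `isClosedImmersion_toProj_comap_of_span`, and fpqc descent along `ℙ_L → ℙ_K` ★ `isClosedImmersion_toProj_of_comap` + ★
  `isClosedImmersion_descendsAlong`).
* §2 **UP and ACROSS** `GeneratingSections.isClosedImmersion_toProj_of_model` — a model `Z / k` with an embedding family `t` of `E`,
  `Y′ = Z ×_k Spec K —e→ Y` an isomorphism over `K`, `M` on `Y` with `e^*M ≅ pr^*E`: every family `s` spanning `Γ(Y, M)` over `K`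
  generates `M` and embeds `Y` ((B4a) UP ★ `isClosedImmersion_toProj_comap`, frame change ★ `ofCocycleSections_ofFrameSystem_eq_of_iso`,
  the span form of the fibre step along `e`).

## References
* R. Hartshorne, *Algebraic Geometry*, GTM 52 (1977), II Thm. 7.1; III Thm. 12.11. [Hartshorne1977]
* A. Grothendieck, J. Dieudonné, *EGA III₁* (Publ. Math. IHÉS 11, 1961), Prop. (1.4.15), Thm. 4.7.1. [EGAIII1]
* The Stacks Project, Tag 02L6 (closed immersions descend along fpqc covers), Tag 02KH. [StacksProject]
* U. Görtz, T. Wedhorn, *Algebraic Geometry II*, (2023), Thm. 23.17 (p. 306). [GortzWedhorn2023]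
-/

noncomputable section

set_option backward.isDefEq.respectTransparency false

open CategoryTheory CategoryTheory.Limits Opposite TopologicalSpace AlgebraicGeometry
open Literature.AlgebraicGeometry.Modules Literature.AlgebraicGeometry.Morphisms
open Literature.AlgebraicGeometry.Motives.GeneratingSections

namespace Literature.AlgebraicGeometry.Motives

/-! ## §0 A finite spanning family of global sections -/

/-- **A coherent module on a proper `k`-scheme has a finite spanning family of global sections** (finiteness of `H⁰`,
Görtz–Wedhorn II Thm. 23.17, through ★ `moduleFinite_msections_of_coh`), in the `SecMod` currency of the (h2) chain and
indexed by some `Fin (m + 1)`. [cite: GortzWedhorn2023, Thm. 23.17 (p. 306)] -/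
theorem exists_fin_span_secMod_eq_top {k : Type} [Field k] {Y : Scheme.{0}} (f : Y ⟶ Spec (.of k)) [IsProper f]
    (E : Y.Modules) (hE : Coh E) :
    ∃ (m : ℕ) (t : Fin (m + 1) → Γ(E, ⊤)),
      Submodule.span Γ(Spec (.of k), ⊤)
        (Set.range fun j ↦ SecMod.mk (L := E) (ρ := f.appTop.hom) (U := ⊤) (t j)) = ⊤ := by
  classical
  haveI : Module.Finite k (MSections f E ⊤) := moduleFinite_msections_of_coh f hE
  haveI hfin : Module.Finite Γ(Spec (.of k), ⊤) (SecMod E f.appTop.hom ⊤) :=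
    Module.Finite.of_addEquiv_semilinear (M := SecMod E f.appTop.hom ⊤) (N := MSections f E ⊤)
      (Scheme.ΓSpecIso (.of k)).hom.hom (Scheme.ΓSpecIso (.of k)).commRingCatIsoToRingEquiv.surjective
      (AddEquiv.refl _) (fun c x => by
        change toSections f.appTop.hom ⊤ c • SecMod.val (L := E) (ρ := f.appTop.hom) x =
          (show Γ(Y, ⊤) from algebraMap k (Sections f ⊤) ((Scheme.ΓSpecIso (.of k)).hom c)) •
            SecMod.val (L := E) (ρ := f.appTop.hom) x
        congr 1
        change Y.presheaf.map (homOfLE le_top).op (f.appTop c) =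
          Y.presheaf.map (homOfLE le_top).op
            (f.appTop ((Scheme.ΓSpecIso (.of k)).inv ((Scheme.ΓSpecIso (.of k)).hom c)))
        rw [Iso.hom_inv_id_apply])
  obtain ⟨n, u, hu⟩ := Module.Finite.exists_fin (R := Γ(Spec (.of k), ⊤)) (M := SecMod E f.appTop.hom ⊤)
  refine ⟨n, Fin.cons 0 (fun j ↦ SecMod.val (L := E) (ρ := f.appTop.hom) (u j)), ?_⟩
  rw [eq_top_iff, ← hu, Submodule.span_le]
  rintro _ ⟨j, rfl⟩
  exact Submodule.subset_span ⟨j.succ, by simp only [Fin.cons_succ]; rfl⟩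

namespace GeneratingSections

/-! ## §1 DOWN a field extension: an embedding family upstairs makes every spanning family downstairs embed -/

section Down

variable {K L : Type} [Field K] [Field L] [Algebra K L] {Y Y' : Scheme.{0}} {f : Y ⟶ Spec (.of K)}
  {f' : Y' ⟶ Spec (.of L)} {h : Y' ⟶ Y} (H : IsPullback h f' f (Spec.map (CommRingCat.ofHom (algebraMap K L))))
  [IsProper f] (E : Y.Modules) (hE : IsAffineLocalizing E) (F : FrameSystem E) (h1 : ∀ x, F.rank x = 1)
  (h1' : ∀ x, (F.pullback h).rank x = 1) {m : ℕ} (t : Fin (m + 1) → Γ(E, ⊤))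
  (ht : Submodule.span Γ(Spec (.of K), ⊤)
    (Set.range fun j ↦ SecMod.mk (L := E) (ρ := f.appTop.hom) (U := ⊤) (t j)) = ⊤)
  {n : ℕ} (s : Fin (n + 1) → Γ((Scheme.Modules.pullback h).obj E, ⊤))
  (hcov : ⨆ i, ⨆ x, Y'.basicOpen ((CocycleSections.ofFrameSystem (F.pullback h) h1' s).coeff i x) = ⊤)
  (Hs : IsClosedImmersion ((ofCocycleSections (F.pullback h).U
    (CocycleSections.ofFrameSystem (F.pullback h) h1' s) hcov).toProj f'))

include H hE ht Hs in
/-- **DOWN a field extension.** `f : Y → Spec K` proper, `Y′ = Y ×_K Spec L`, `E` an affine-localizing `𝒪_Y`-module with a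
rank-one frame system `F`, `t` a family spanning `Γ(Y, E)` over `K`; if SOME family `s` of sections of `h^*E` (in the pulled-back
frames) generates it and embeds `Y′ ↪ ℙⁿ_L`, then `t` generates `E` and embeds `Y ↪ ℙᵐ_K`.  Flat base change of `H⁰` (★
`span_unitSectionLE_top_eq_top_of_flat`) puts each `sᵢ` in the `L`-span of the restricted `η(t_j)`; the span form of the fibre
step (★ `isClosedImmersion_toProj_comap_of_span`) makes the `η(t_j)` embed `Y′`; that datum is the pull-back of the datum of `t` (★
`ofCocycleSections_comap`), whose morphism to `ℙᵐ_K` is therefore a closed immersion by fpqc descent along `ℙᵐ_L → ℙᵐ_K` (★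
`isClosedImmersion_toProj_of_comap`, ★ `isClosedImmersion_descendsAlong`). [cite: StacksProject, Tag 02L6] [cite: EGAIII1, Prop. (1.4.15)]
[cite: Hartshorne1977, II Thm. 7.1] -/
theorem isClosedImmersion_toProj_of_fieldExtension :
    ∃ hcovt : ⨆ j, ⨆ x, Y.basicOpen ((CocycleSections.ofFrameSystem F h1 t).coeff j x) = ⊤,
      IsClosedImmersion ((ofCocycleSections F.U (CocycleSections.ofFrameSystem F h1 t) hcovt).toProj f) := by
  classical
  haveI : IsProper f' := MorphismProperty.of_isPullback H inferInstance
  -- `Spec L → Spec K` is surjective and flat; so is `h`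
  have hKf : IsField Γ(Spec (CommRingCat.of K), ⊤) :=
    MulEquiv.isField (Field.toIsField K) (Scheme.ΓSpecIso (.of K)).commRingCatIsoToRingEquiv.toMulEquiv
  haveI : Surjective (Spec.map (CommRingCat.ofHom (algebraMap K L))) :=
    ⟨fun x => ⟨default, Subsingleton.elim _ _⟩⟩
  haveI : Flat (Spec.map (CommRingCat.ofHom (algebraMap K L))) :=
    (HasRingHomProperty.Spec_iff (P := @Flat)).mpr (RingHom.Flat.of_isField (Field.toIsField K) _)
  haveI : Surjective h := MorphismProperty.of_isPullback H.flip inferInstance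
  -- (1) flat base change of `H⁰`: the restricted sections `η(u)`, `u ∈ Γ(Y, E)`, span `Γ(Y′, h^*E)` over `L`
  obtain ⟨ι, _, _, U, hU, hUa⟩ := Literature.AlgebraicGeometry.Morphisms.exists_finite_affine_cover_cechOpen f
  have hflat : ((Spec.map (CommRingCat.ofHom (algebraMap K L))).appLE ⊤ ⊤ le_top).hom.Flat :=
    RingHom.Flat.of_isField hKf _
  letI := ((Spec.map (CommRingCat.ofHom (algebraMap K L))).appLE ⊤ ⊤ le_top).hom.toAlgebra
  have hspan := span_unitSectionLE_top_eq_top_of_flat H U hU hUa E hE hflat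
  have hs' := Literature.AlgebraicGeometry.Morphisms.span_range_unitSectionLE_comp_eq_top_of_span H E t ht hspan
  have hs : ∀ i, SecMod.mk (L := (Scheme.Modules.pullback h).obj E) (ρ := f'.appTop.hom) (U := ⊤) (s i) ∈
      Submodule.span Γ(Spec (.of L), ⊤) (Set.range fun j ↦
        SecMod.mk (L := (Scheme.Modules.pullback h).obj E) (ρ := f'.appTop.hom) (U := ⊤)
          (unitSectionLE h E (V := ⊤) (U := ⊤) le_top (t j))) := fun i ↦ by
    rw [hs']
    exact Submodule.mem_top
  -- (2) the span form of the fibre step: the `η(t_j)` generate along `h` and embed `Y′`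
  obtain ⟨hgen, hcov₀, H₀⟩ :=
    Literature.AlgebraicGeometry.Morphisms.isClosedImmersion_toProj_comap_of_span h f' F h1 h1' s hcov Hs t hs
  -- (3) `h` is onto, so the `t_j` generate `E`
  have hcovt : ⨆ j, ⨆ x, Y.basicOpen ((CocycleSections.ofFrameSystem F h1 t).coeff j x) = ⊤ := by
    refine (iSup_basicOpen_coeffAt_eq_top_iff F h1 t).mpr fun x ↦ ?_
    obtain ⟨y, rfl⟩ := h.surjective x
    exact hgen y
  refine ⟨hcovt, ?_⟩
  -- (4) the datum of the `η(t_j)` is the pull-back of the datum of `t`; descend along `ℙᵐ_L → ℙᵐ_K`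
  haveI : IsClosedImmersion
      (((ofCocycleSections F.U (CocycleSections.ofFrameSystem F h1 t) hcovt).comap h).toProj f') := by
    rw [← ofCocycleSections_comap h (CocycleSections.ofFrameSystem F h1 t) hcovt]
    exact H₀
  exact (ofCocycleSections F.U _ hcovt).isClosedImmersion_toProj_of_comap f f' h H

end Down

/-! ## §2 UP a field extension and across an isomorphism: the model's embedding family makes the given family embed -/

section Model

variable {k K : Type} [Field k] [Field K] [Algebra k K] {Z Y' Y : Scheme.{0}} {g : Z ⟶ Spec (.of k)}
  {f : Y ⟶ Spec (.of K)} [IsProper f] (pr : Y' ⟶ Z) (e : Y' ⟶ Y) [IsIso e]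
  (Hpr : IsPullback pr (e ≫ f) g (Spec.map (CommRingCat.ofHom (algebraMap k K))))
  (E : Z.Modules) (F₁ : FrameSystem E) (h1₁ : ∀ x, F₁.rank x = 1) (h1pr : ∀ x, (F₁.pullback pr).rank x = 1)
  {m : ℕ} (t : Fin (m + 1) → Γ(E, ⊤))
  (hcovt : ⨆ j, ⨆ x, Z.basicOpen ((CocycleSections.ofFrameSystem F₁ h1₁ t).coeff j x) = ⊤)
  (Ht : IsClosedImmersion ((ofCocycleSections F₁.U (CocycleSections.ofFrameSystem F₁ h1₁ t) hcovt).toProj g))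
  (M : Y.Modules) (hM : IsAffineLocalizing M)
  (ψ : (Scheme.Modules.pullback pr).obj E ≅ (Scheme.Modules.pullback e).obj M)
  (F : FrameSystem M) (h1 : ∀ x, F.rank x = 1) (h1e : ∀ x, (F.pullback e).rank x = 1)
  {n : ℕ} (s : Fin (n + 1) → Γ(M, ⊤))
  (hs : ∀ σ : Γ(M, ⊤), SecMod.mk (L := M) (ρ := f.appTop.hom) (U := ⊤) σ ∈
    Submodule.span Γ(Spec (.of K), ⊤) (Set.range fun j ↦ SecMod.mk (L := M) (ρ := f.appTop.hom) (U := ⊤) (s j)))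

include Hpr Ht hM ψ h1pr h1e hs in
/-- **UP a field extension and ACROSS an isomorphism.** `g : Z → Spec k` (the model), `f : Y → Spec K` proper, `k → K`,
`e : Y′ ⥲ Y` an isomorphism and `pr : Y′ → Z` with `Y′ = Z ×_k Spec K`; a family `t` of sections of `E` on the model generating
it and embedding `Z ↪ ℙᵐ_k`; a module `M` on `Y` with `e^*M ≅ pr^*E` (`ψ`), affine-localizing, with a rank-one frame system
`F` and a family `s` spanning `Γ(Y, M)` over `K`.  Then `s` generates `M` and embeds `Y ↪ ℙⁿ_K`: base change makes
`η_pr(t)` embed `Y′` ((B4a) UP, ★ `ofCocycleSections_comap`, ★ `ofCocycleSections_ofFrameSystem_pullback`); frame change (★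
`ofCocycleSections_ofFrameSystem_eq_of_iso`) moves this to `(e^*M, F.pullback e)`; the `η_e(s_j)` span `Γ(Y′, e^*M)` (flat base
change along `𝟙_{Spec K}`), so the span form of the fibre step (★ `isClosedImmersion_toProj_comap_of_span`) makes `s` generate and
the pulled-back datum of `s` embed `Y′`, i.e. `e ≫ (toProj f of s)` is a closed immersion (★ `comap_toProj`), `e` an isomorphism.
[cite: Hartshorne1977, II Thm. 7.1] [cite: EGAIII1, Thm. 4.7.1] -/
theorem isClosedImmersion_toProj_of_model :
    ∃ hcov : ⨆ i, ⨆ x, Y.basicOpen ((CocycleSections.ofFrameSystem F h1 s).coeff i x) = ⊤,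
      IsClosedImmersion ((ofCocycleSections F.U (CocycleSections.ofFrameSystem F h1 s) hcov).toProj f) := by
  classical
  haveI : Surjective e := inferInstance
  -- (1) UP: the pulled-back datum of `t` embeds `Y′`
  haveI : IsClosedImmersion ((ofCocycleSections F₁.U (CocycleSections.ofFrameSystem F₁ h1₁ t) hcovt).toProj g) := Ht
  have H₁ := (ofCocycleSections F₁.U (CocycleSections.ofFrameSystem F₁ h1₁ t) hcovt).isClosedImmersion_toProj_comap
    g (e ≫ f) pr Hpr
  -- … which is the datum of the family `η_pr(t)` of `pr^*E` in the pulled-back frames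
  have hcov₁ : ⨆ j, ⨆ x, Y'.basicOpen ((CocycleSections.ofFrameSystem (F₁.pullback pr) h1pr
      (fun j ↦ unitSectionLE pr E (V := ⊤) (U := ⊤) le_top (t j))).coeff j x) = ⊤ := by
    refine (iSup_basicOpen_coeffAt_eq_top_iff (F₁.pullback pr) h1pr _).mpr fun x ↦ ?_
    obtain ⟨j, hj⟩ := (iSup_basicOpen_coeffAt_eq_top_iff F₁ h1₁ t).mp hcovt (pr.base x)
    refine ⟨j, ?_⟩
    rw [coeffAt_pullback pr F₁ h1₁ t h1pr j x, ← Scheme.preimage_basicOpen]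
    exact hj
  have H₂ : IsClosedImmersion ((ofCocycleSections (F₁.pullback pr).U (CocycleSections.ofFrameSystem (F₁.pullback pr) h1pr
      (fun j ↦ unitSectionLE pr E (V := ⊤) (U := ⊤) le_top (t j))) hcov₁).toProj (e ≫ f)) := by
    rw [ofCocycleSections_ofFrameSystem_pullback pr F₁ h1₁ t h1pr hcov₁
      (CocycleSections.iSup_basicOpen_comap_coeff pr _ hcovt), ofCocycleSections_comap pr _ hcovt]
    exact H₁
  -- (2) frame change: the same datum from `(e^*M, F.pullback e)` and the family `ψ(η_pr(t))`
  obtain ⟨hcov₂, hW₂⟩ := ofCocycleSections_ofFrameSystem_eq_of_iso ψ (F₁.pullback pr) (F.pullback e) h1pr h1e _ hcov₁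
  have H₃ : IsClosedImmersion ((ofCocycleSections (F.pullback e).U (CocycleSections.ofFrameSystem (F.pullback e) h1e
      (fun j ↦ ψ.hom.app ⊤ (unitSectionLE pr E (V := ⊤) (U := ⊤) le_top (t j)))) hcov₂).toProj (e ≫ f)) := by
    rw [← hW₂]
    exact H₂
  -- (3) the restrictions `η_e(s_j)` span `Γ(Y′, e^*M)` over `K` (flat base change along `𝟙_{Spec K}`)
  have sq : IsPullback e (e ≫ f) f (𝟙 _) := IsPullback.of_horiz_isIso ⟨(Category.comp_id _).symm⟩
  have hKf : IsField Γ(Spec (CommRingCat.of K), ⊤) :=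
    MulEquiv.isField (Field.toIsField K) (Scheme.ΓSpecIso (.of K)).commRingCatIsoToRingEquiv.toMulEquiv
  obtain ⟨ι, _, _, U, hU, hUa⟩ := exists_finite_affine_cover_cechOpen f
  have hflat : (Scheme.Hom.appLE (𝟙 (Spec (CommRingCat.of K))) ⊤ ⊤ le_top).hom.Flat :=
    RingHom.Flat.of_isField hKf _
  letI := (Scheme.Hom.appLE (𝟙 (Spec (CommRingCat.of K))) ⊤ ⊤ le_top).hom.toAlgebra
  have hspan := span_unitSectionLE_top_eq_top_of_flat sq U hU hUa M hM hflat
  have hstop : Submodule.span Γ(Spec (.of K), ⊤)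
      (Set.range fun j ↦ SecMod.mk (L := M) (ρ := f.appTop.hom) (U := ⊤) (s j)) = ⊤ :=
    eq_top_iff.mpr fun x _ ↦ hs (SecMod.val (L := M) (ρ := f.appTop.hom) x)
  have hs' := span_range_unitSectionLE_comp_eq_top_of_span sq M s hstop hspan
  have hs'' : ∀ i, SecMod.mk (L := (Scheme.Modules.pullback e).obj M) (ρ := (e ≫ f).appTop.hom) (U := ⊤)
      (ψ.hom.app ⊤ (unitSectionLE pr E (V := ⊤) (U := ⊤) le_top (t i))) ∈
      Submodule.span Γ(Spec (.of K), ⊤) (Set.range fun j ↦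
        SecMod.mk (L := (Scheme.Modules.pullback e).obj M) (ρ := (e ≫ f).appTop.hom) (U := ⊤)
          (unitSectionLE e M (V := ⊤) (U := ⊤) le_top (s j))) := fun i ↦ by
    rw [hs']
    exact Submodule.mem_top
  -- (4) the span form of the fibre step along `e`: the pulled-back datum of `s` embeds `Y′`
  obtain ⟨hgen, hcov₀, H₀⟩ := isClosedImmersion_toProj_comap_of_span e (e ≫ f) F h1 h1e _ hcov₂ H₃ s hs''
  have hcov : ⨆ i, ⨆ x, Y.basicOpen ((CocycleSections.ofFrameSystem F h1 s).coeff i x) = ⊤ := by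
    refine (iSup_basicOpen_coeffAt_eq_top_iff F h1 s).mpr fun x ↦ ?_
    obtain ⟨y, rfl⟩ := e.surjective x
    exact hgen y
  refine ⟨hcov, ?_⟩
  have H₄ : IsClosedImmersion
      (((ofCocycleSections F.U (CocycleSections.ofFrameSystem F h1 s) hcov).comap e).toProj (e ≫ f)) := by
    rw [← ofCocycleSections_comap e _ hcov]
    exact H₀
  rw [comap_toProj] at H₄
  exact (MorphismProperty.cancel_left_of_respectsIso @IsClosedImmersion e _).mp H₄

end Model

end GeneratingSections

end Literature.AlgebraicGeometry.Motives

end
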